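import Mathlib
import HarnessLib
import HarnessLib.Audit
import Summits.Langlands.Statement

/-!
Route: CubicSurfaceE6Transport

CLOSED (retired) 2026-08-15T13:48:40Z by operator:999:1257524 — reason: not-a-thesis: assembly does not conclude the sub-problem Statement — note: D-0027 §2.1 audit (human 2026-08-15: routes that do not decide the summit are removed): the assembly concludes `OccultTypeAutomorphy`, not the sub-problem statement; a NEW conforming route may be opened from the same idea (generated `closes : … → _root_.Langlands`).. The file is kept as the record of this route; refuted decls are indexed as negative knowledge (`ledger negatives`).

Route CubicSurfaceE6Transport (card Langlands/Langlands/cubic-surface-e6-transport). INSTANCE ROUTE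
for conjunct (B)
`GaloisToAutomorphic` with n = 5, K = ℚ(ω) = CyclotomicField 3 ℚ (the summit `Langlands` is not
implied and the assembly
ends in the route target, not in `Langlands` — said plainly here so no refuter has to discover it).

Thesis X = `OccultTypeAutomorphy`: every rank-5 compatible system 𝓢 over K (tree `CompatibleSystem K
E 5`) which is
(i) absolutely irreducible at a place λ ∣ 3 of its coefficient field, (ii) polarised
(conjugate-self-dual up to an integral
Tate twist, written as an identity of Frobenius polynomials), and (iii) of OCCULT RESIDUAL TYPE —
its Frobenius polynomials
reduce mod λ to those of ρ̄|Γ_K for some ρ̄ : Γ_ℚ → SO₅(𝔽₃) ≅ W(E₆) which is surjective, has spinor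
parity equal to the
mod-3 cyclotomic character, tr ρ̄(c) = 1, is unramified at 2 with Frob₂-polynomial ≠ (X-1)³(X²+1),
and has inertia at 3
acting through {1, t}, t an involution of trace 1 — is AUTOMORPHIC: for every embedding E → ℂ there
is an L-algebraic
cuspidal π on GL₅(𝔸_K) whose Satake parameters match 𝓢.charpoly at almost all places (the a.e. form
of (B); LGC at the
finitely many remaining places is deliberately not in X). The motivating members of the class are
the "occult" λ-adic
realisations H³(T_S)_ω (T_S → ℙ³ the cyclic cubic threefold of a smooth cubic surface S/ℚ;
Allcock–Carlson–Toledo,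
Achter): U(4,1)-motives of IRREGULAR Hodge–Tate type {0,1,1,1,1}/{0,0,0,0,1} whose mod-(1-ω)
reduction is the 27-line
representation of S (crux OccultSystemIsE6Type, informal until the definition items land).

It suffices to show X because X is literally a family of instances of direction (B) for irreducible
geometric ρ of
dimension 5 over K = ℚ(ω) in irregular weight — a sector where (B) is known for no non-CM,
non-induced example.
Two-layer plan: cruxes E6ResidualTransport (rank 2) → PolarisedLiftingRank5 (rank 3) →
OccultSystemIsE6Type (rank 4,
informal); Assembly := E6ResidualTransport → PolarisedLiftingRank5 → OccultTypeAutomorphy is pure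
glue (proved in the
planner sketch: restrict ρ̄ to Γ_K and feed crux A's residual automorphy into crux B). Glue/splits
later, only after a
crux closes.

Rationale: WHY THIS LINE (geometric/motivic lift + exceptional isomorphism; sources
BCGP2025ModularityAbelianSurfaces, BoxerEtAl2021,
AllcockCarlsonToledo2002, Achter2020, ElsenhansJahnel2011, Hunt1996, Pilloni2012, GeeTaibi2019,
Kim2002, ArthurClozel1989).
The one finite group W(E₆) ≅ SO₅(𝔽₃) ≅ PGSp₄(𝔽₃) (order 51840) is at once the symmetry group of the
27 lines, the reduction
mod (1-ω) of the Allcock–Carlson–Toledo Eisenstein lattice Λ_S = H³(T_S,ℤ) of signature (4,1)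
(Achter: Galois-equivariantly),
and the 3-torsion monodromy of principally polarised abelian surfaces (Burkhardt quartic = A₂(3)).
Reading BCGP 2025 §9.4–9.5
(held text, Lemma "switching" + Thm 1 proof) shows the paper already contains RESIDUAL modularity of
an ABSTRACT
ρ̄ : Γ_ℚ → GSp₄(𝔽₃) with similitude ε̄⁻¹, ρ̄^∨|Γ_{ℚ₃} ordinary finite flat, unramified at 2 with
Frob₂ ∉ {4C,12C}: P(ρ̄) is
rational, weak approximation gives B = Jac(X)/ℚ with B[3] ≅ ρ̄, and the 2–3 switch makes B modular.
Transport through ∧²₀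
turns the 27-line representation (twisted into SO₅ by its own determinant) into such a ρ̄; Hida
theory (Pilloni2012) moves
to regular weight, Arthur (GeeTaibi2019) + Kim's ∧² (Kim2002) + Arthur–Clozel base change land a
RACSDC Π on GL₅(𝔸_K) with
r̄(Π) ≅ ρ̄'|Γ_K: residual automorphy of the occult U(4,1)-motive of a cubic surface. Downstream is
the rank-5 analogue of the
BCGP irregular-weight machine on the ACT ball quotient (higher Hida theory + Pan-style classicality
at the ramified prime 3).
Planner's correction to the card (the load-bearing bookkeeping, all finite group theory): the
similitude of every
GSp₄(𝔽₃)-lift is FORCED to be the spinor parity of ρ̄' = det∘ρ̄₂₇ = χ_{-3Δ(S)} (ElsenhansJahnel2011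
Thm 2.12), so B[3] ≅ lift
needs Δ(S) ∈ ℚ^{×2}; good reduction at 3 is IMPOSSIBLE (unramified ρ̄' ⇒ unramified similitude ≠
ε̄); inertia at 3 must act
through {1,t} with t of A₁³ type (tr 1, hyperbolic (-1)-plane ↔ diag(-1,-1,1,1) with ν = -1 =
ordinary finite-flat shape),
complex conjugation must be of A₁³ type (3 real lines; Clebsch-type 27 real lines excluded), and
BCGP's Frob₂ condition reads
charpoly ρ̄'(Frob₂) ≠ (X-1)³(X²+1). These are exactly the hypotheses typed in crux
E6ResidualTransport.

RANKED CRUXES. #2 E6ResidualTransport: every ρ̄ : Γ_ℚ → SO₅(𝔽₃) with the listed local type is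
residually automorphic over
K in regular weight (typed: ∃ RA cuspidal π on GL₅(𝔸_K) with q²-normalised Hecke polynomials
congruent to ρ̄|Γ_K) — theorem-
sized modulo 4–5 unvendored named facts (cite items filed) and the bookkeeping above; kill-tests are
finite. #3
PolarisedLiftingRank5: automorphy of polarised, absolutely irreducible rank-5 compatible systems
over K that reduce at λ∣3
to a residually automorphic ρ̄_K with image ⊇ Ω₅(𝔽₃) — AS TYPED it carries no ordinarity/weight
hypothesis at λ (no carrier
for labelled Hodge–Tate weights or P-ordinary flags; definition item IsPOrdinaryAt filed), so it is
strictly stronger than the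
programme's deliverable (μ-ordinary higher Hida theory for GU(4,1)/ℚ at p = 3 + irregular R = 𝕋 +
Sen/Cousin classicality on
the ACT ball quotient); it is the hardest node and the one to SPLIT first in tenure. #4
OccultSystemIsE6Type (informal until
CubicSurface.linesOrthogonalRep / occultSystem land): smooth cubic surfaces S/ℚ with Gal(lines) =
W(E₆), Δ(S) a square, the
right type at ∞, 2, 3 EXIST, and their occult systems satisfy (i)–(iii) with ρ̄ = det(ρ̄₂₇)·ρ̄₂₇
(ACT + Achter + Poincaré
duality, a = ±3). Support: WeylE6IsoSO5F3, Sp4F3OntoOmega5 (finite, kernel-checkable dictionary).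
KILL CRITERIA. Route closes refuted if (a) a counterexample ρ̄ to E6ResidualTransport is certified
(e.g. the similitude/
P(ρ̄)(ℚ₃)-point bookkeeping fails for some admissible local type — finite computation over 𝔽₃/ℚ₃),
or (b) no cubic surface
meets the local+discriminant conditions (then pivot: F = ℚ(√Δ) totally real, needing BCGP over
totally real fields), or
(c) PolarisedLiftingRank5 is refuted in its typed generality AND no typed P-ordinary restatement
survives.
NOT DECOMPOSED YET: the higher-Hida/classicality interior of #3 (split only after #2 closes or
IsPOrdinaryAt lands); LGC at
bad places; the weight-0 Artin motive of S itself (explicitly NOT claimed: HT weight 0,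
NonRegularWeight wall).

Novelty: Nearest prior art (searched 2026-08-15: the card's zbMATH/Crossref sweep + mine: `lit read
arxiv:2502.20645` pp.3-5,135-138
(BCGP2025ModularityAbelianSurfaces: Lemma "switching" 9.4 + Thm 1 proof = residual modularity of
abstract rhobar: G_Q -> GSp4(F3)
with similitude epsbar^-1, ordinary finite-flat at 3, unramified at 2, Frob2 not 4C/12C — the
theorem transported),
`lit search --source zbmath "Elsenhans Jahnel discriminant cubic surface"` -> ElsenhansJahnel2011 =
arXiv:1006.0721 Thm 2.12
(p.5: Gal(lines) in D^1W(E6) iff -3Delta square), zbMATH "occult period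
cubic surface arithmetic" (0 automorphic hits), `lit galaxy search "Burkhardt quartic" --star all`
(Hunt1996, geometry only), `lit frontier Langlands --since 2023` (arXiv:2602.04778 R=T for
orthogonal Shimura varieties:
regular weight, different group). AllcockCarlsonToledo2002 (doi:10.1090/s1056-3911-02-00314-4) and
Achter2020
(doi:10.14231/AG-2020-021) give the occult lattice and its Galois-equivariance; BoxerEtAl2021 gives
P(rhobar) rational.
DELTA: nobody has used W(E6) = SO5(F3) = PGSp4(F3) (realised by wedge^2_0) to move modularity of
abelian surfaces onto the
occult U(4,1)-motives of cubic surfaces; new here beyond the card: the similitude/spinor bookkeeping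
(square discriminant,
no good reduction at 3, A1^3 inertia and complex conjugation, Frob2-polynomial (X-1)^3(X^2+1)) that
makes the transport a
precise typed statement, and the typed irregular polarised lifting target over Q(omega). Expected
grade: new-combin  [refs: 10.1090/s1056-3911-02-00314-4, 10.14231/AG-2020-021, 2502.20645, 1006.0721, 2602.04778, arxiv:2502.20645, doi:10.1090/s1056-3911-02-00314-4, doi:10.14231/AG-2020-021, ElsenhansJahnel2011, Hunt1996, AllcockCarlsonToledo2002, Achter2020, BoxerEtAl2021]

Barriers (technique_class: higher-hida irregular-weight automorphy-lifting patching): technique_class: higher-hida irregular-weight automorphy-lifting patching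
- Literature.Barriers.Langlands.NonRegularWeightBarrier: MET head-on (occult HT type
{0,1,1,1,1}/{0,0,0,0,1}); evasion = the catalogued one (BCGP): coherent cohomology of the ACT ball
quotient in two degrees + higher Hida/Coleman theory + Sen=Cousin classicality; crux
PolarisedLiftingRank5 is where this is paid; the weight-0 Artin motive of S is NOT claimed.
- Literature.Barriers.Langlands.TaylorWilesNumericalCoincidence: U(4,1)/Q has a Shimura variety and
l_0 > 0 only in the sense of irregular weight: patched objects are perfect complexes of ordinary
coherent cohomology (Calegari-Geraghty/BCGP style), the catalogued evasion; no GL_n-over-CM defect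
is incurred because the representation is polarised (crux hypothesis (ii)).
- Literature.Barriers.Langlands.TaylorWilesNumericalCoincidenceNarrow: base Q, unitary (polarised)
rank 5 — inside the narrow form's admissible regime; recorded, not fought.
- Literature.Barriers.Langlands.PatchingLocalComponentBarrier: met at lambda = (1-omega) (ramified p
= 3): single P-ordinary component is the bet; non-ordinary cubic surfaces (off the
mu-ordinary/generic Newton stratum) are conceded; the untyped P-ordinary hypothesis is flagged on
crux B (definition item IsPOrdinaryAt).
- Literature.Barriers.Langlands.ResiduallyReducibleBarrier: evaded by hypothesis: residual image
contains Omega5(F3) = PSp4(F3) (absolutely irreducible on F3^5); adequacy at p = 3 (p divides the im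

History (route lifecycle, newest last):
- 2026-08-15T13:48:41Z · CLOSED retired — not-a-thesis: assembly does not conclude the sub-problem Statement (operator:999:1257524)

sub-problem: Langlands · status: closed(retired) · opened planner-plancard-Langlands-Langlands-cubic-su-8ab83e6d-0 2026-08-15T11:10:40Z · rev 1 · ledger route-Langlands-CubicSurfaceE6Transport
GENERATED by the gate from the ledger (D-0016/17). Provers cite these decls: `theorem foo : Summit.Langlands.Langlands.Theses.CubicSurfaceE6Transport.<Decl> := …` in Summits/Langlands/Langlands/Theorems/<Name>.lean.
-/

namespace Summit.Langlands.Langlands.Theses.CubicSurfaceE6Transport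

open scoped BigOperators Topology Manifold Classical MeasureTheory ProbabilityTheory Matrix InnerProductSpace ComplexConjugate ContinuousMap
open Filter Set Function TopologicalSpace MeasureTheory

attribute [summit_statement] _root_.Langlands

/-- item stmt-Langlands-3055 · target · rank 0 · closed · moot by None · by planner
why it might fail: Implied by conjunct (B) for n = 5 over Q(omega); fails only with the summit. As a programme: irregular HT type {0,1,1,1,1} off the mu-ordinary locus has no method (NonRegularWeightBarrier); the typed class (iii) may be empty if no cubic surface meets the local conditions (then vacuous, not false).
sources: AllcockCarlsonToledo2002, Achter2020, BCGP2025ModularityAbelianSurfaces, BuzzardGeeLMS2014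
[target] Thesis X; K = CyclotomicField 3 ℚ = ℚ(ω). Every rank-5 compatible system 𝓢 over K (tree
CompatibleSystem: ARITHMETIC-Frobenius charpolys) which is absolutely irreducible at some λ ∣ 3,
POLARISED (∃ a : ℤ: charpoly at the conjugate place = monic q^a-reciprocal transform; a = ±3 for the
occult motive by Poincaré duality pairing the ω/ω̄ eigenspaces) and of OCCULT RESIDUAL TYPE (reduces
a.e. mod λ to ρ̄|Γ_K, ρ̄ : Γ_ℚ → SO₅(𝔽₃) surjective, spinor parity = mod-3 cyclotomic character [σ
fixes ζ₃ iff ρ̄σ ∈ ⟨squares⟩ = Ω₅(𝔽₃)], tr ρ̄(c) = 1, unramified at 2 with Frob₂-charpoly ≠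
(X-1)³(X²+1), inertia at 3 = {1,t}, t² = 1, tr t = 1; image of Γ_K ∋ all commutators of SO₅(𝔽₃)) is
AUTOMORPHIC: ∀ emb : E →+* ℂ, ∃ L-algebraic cuspidal π on GL₅(𝔸_K) with (𝓢.charpoly v).map emb =
∏_{a ∈ Satake(π_v)} (X - a⁻¹) a.e.. Intended members: ρ_S^∨ (or ρ_S(3)) for the occult realisation
H³(T_S)_ω of a smooth cubic surface S/ℚ [AllcockCarlsonToledo2002, Achter2020], IRREGULAR HT type
{0,1,1,1,1}/{0,0,0,0,1}: (B)-instances for n = 5 over ℚ(ω), none known beyond CM/induced. Abstract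
because cubic surfaces/étale H³ lack a Lean carrier (definition items filed). -/
@[route_item "route-Langlands-CubicSurfaceE6Transport"]
def OccultTypeAutomorphy : Prop :=
  open Literature.NumberTheory.GaloisRepresentations Literature.NumberTheory.Automorphic Polynomial NumberField IsDedekindDomain in ∀ (E : Type) [Field E] [NumberField E] (𝓢 : CompatibleSystem (CyclotomicField 3 ℚ) E 5), (∃ («λ» : HeightOneSpectrum (𝓞 E)) (j : ZMod 3 →+* 𝓞 E ⧸ «λ».asIdeal) (ρ : FramedGaloisRep ℚ (ZMod 3) 5), ((∀ σ, ((ρ σ : GL (Fin 5) (ZMod 3)) : Matrix (Fin 5) (Fin 5) (ZMod 3))ᵀ * (ρ σ : GL (Fin 5) (ZMod 3)) = 1 ∧ Matrix.det ((ρ σ : GL (Fin 5) (ZMod 3)) : Matrix (Fin 5) (Fin 5) (ZMod 3)) = 1) ∧ (∀ g : Matrix (Fin 5) (Fin 5) (ZMod 3), gᵀ * g = 1 → g.det = 1 → ∃ σ, ((ρ σ : GL (Fin 5) (ZMod 3)) : Matrix (Fin 5) (Fin 5) (ZMod 3)) = g) ∧ (∀ (σ : Field.absoluteGaloisGroup ℚ)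 (ζ : AlgebraicClosure ℚ), ζ ^ 2 + ζ + 1 = 0 → (σ • ζ = ζ ↔ ρ σ ∈ Subgroup.closure ((fun x : GL (Fin 5) (ZMod 3) ↦ x * x) '' {x | ((x : GL (Fin 5) (ZMod 3)) : Matrix (Fin 5) (Fin 5) (ZMod 3))ᵀ * x = 1}))) ∧ (∀ (φ : ℚ →+* ℝ) (c : Field.absoluteGaloisGroup ℚ), IsComplexConjugation φ c → Matrix.trace ((ρ c : GL (Fin 5) (ZMod 3)) : Matrix (Fin 5) (Fin 5) (ZMod 3)) = 1) ∧ (∀ v : HeightOneSpectrum (𝓞 ℚ), (2 : 𝓞 ℚ) ∈ v.asIdeal → ρ.IsUnramifiedAt v ∧ ∀ P, ρ.HasFrobCharpolyAt v P → P ≠ (X - 1) ^ 3 * (X ^ 2 + 1)) ∧ (∀ v : HeightOneSpectrum (𝓞 ℚ), (3 : 𝓞 ℚ) ∈ v.asIdeal → ∀ 𝔓 ∈ v.primesAbove, ∃ t : Matrix (Fin 5) (Fin 5) (ZMod 3), t * t = 1 ∧ Matrix.trace t = 1 ∧ (∀ σ ∈ 𝔓.inertia (Field.absoluteGaloisGroup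 ℚ), ((ρ σ : GL (Fin 5) (ZMod 3)) : Matrix (Fin 5) (Fin 5) (ZMod 3)) = 1 ∨ ((ρ σ : GL (Fin 5) (ZMod 3)) : Matrix (Fin 5) (Fin 5) (ZMod 3)) = t) ∧ (∃ σ ∈ 𝔓.inertia (Field.absoluteGaloisGroup ℚ), ((ρ σ : GL (Fin 5) (ZMod 3)) : Matrix (Fin 5) (Fin 5) (ZMod 3)) = t))) ∧ (∀ g h : Matrix (Fin 5) (Fin 5) (ZMod 3), gᵀ * g = 1 → g.det = 1 → hᵀ * h = 1 → h.det = 1 → ∃ σ, ((ρ.restrictField (CyclotomicField 3 ℚ) σ : GL (Fin 5) (ZMod 3)) : Matrix (Fin 5) (Fin 5) (ZMod 3)) = g * h * g⁻¹ * h⁻¹) ∧ FramedRep.IsAbsolutelyIrreducible (𝓢.rep «λ») ∧ (∀ᶠ v : HeightOneSpectrum (𝓞 (CyclotomicField 3 ℚ)) in cofinite, ∃ P₀ : Polynomial (𝓞 E), P₀.map (algebraMap (𝓞 E) E) = 𝓢.charpoly v ∧ ∀ 𝔓 ∈ v.primesAbove, ∀ σ : Field.absoluteGaloisGroup (CyclotomicField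 3 ℚ), IsArithFrobAt (𝓞 (CyclotomicField 3 ℚ)) σ 𝔓 → ((ρ.restrictField (CyclotomicField 3 ℚ) σ : GL (Fin 5) (ZMod 3)) : Matrix (Fin 5) (Fin 5) (ZMod 3)).charpoly.map j = P₀.map (Ideal.Quotient.mk «λ».asIdeal))) → (∃ a : ℤ, ∀ σ : CyclotomicField 3 ℚ ≃ₐ[ℚ] CyclotomicField 3 ℚ, σ ≠ AlgEquiv.refl → ∀ v w : HeightOneSpectrum (𝓞 (CyclotomicField 3 ℚ)), v ∉ 𝓢.bad → w ∉ 𝓢.bad → w.asIdeal = Ideal.comap (RingOfIntegers.mapRingHom σ.toRingEquiv.toRingHom) v.asIdeal → 𝓢.charpoly w = C ((𝓢.charpoly v).coeff 0)⁻¹ * ((𝓢.charpoly v).comp (C ((v.residueCard : E) ^ a) * X)).reverse) → ∀ (emb : E →+* ℂ) (hcpt : isCompact_glFiniteIntegralLevel 5 (CyclotomicField 3 ℚ)), ∃ π : CuspidalAutomorphicRepData 5 (CyclotomicField 3 ℚ) hcpt, π.1.IsLAlgebraic ∧ ∀ᶠ v : HeightOneSpectrum (𝓞 (CyclotomicField 3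 ℚ)) in cofinite, ∃ α : Multiset ℂ, π.1.HasSatakeParamAt v α ∧ (𝓢.charpoly v).map emb = (α.map fun a ↦ X - C a⁻¹).prod

/-- item stmt-Langlands-3056 · crux · rank 2 · closed · moot by None · by planner
why it might fail: Needs 5 unvendored facts (BCGP2025 switching lemma + 2-adic modularity, Hida for GSp4, Arthur GSp4->GL4 + Kim wedge2, cyclic BC) and bookkeeping: a P(rhobar)(Q3)-point with good ordinary reduction for EVERY admissible type at 3, big-image regular specialisation, cuspidality of the GL5 transfer.
sources: BCGP2025ModularityAbelianSurfaces, BoxerEtAl2021, Pilloni2012, GeeTaibi2019, Kim2002, ArthurClozel1989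
[crux, rank 2: the transport; theorem-sized modulo named facts] ρ̄ : Γ_ℚ → SO₅(𝔽₃) (gᵀg = 1, det 1)
surjective (≅ W(E₆)), spinor parity = ε̄ (σ fixes ζ₃ iff ρ̄σ ∈ ⟨squares of O₅(𝔽₃)⟩ = Ω₅(𝔽₃) =
W(E₆)′), tr ρ̄(c) = 1 (⇒ GSp₄-lift of c = diag(-1,-1,1,1), ν = -1), unramified at 2 with
Frob₂-charpoly ≠ (X-1)³(X²+1) (= BCGP: GSp₄-charpoly ≠ (x²±x+2)²), inertia at 3 = {1,t}, t
involution of trace 1 (⇒ lift ε̄U₁ ⊕ U₂ ordinary, finite flat) ⟹ ρ̄|Γ_K RESIDUALLY AUTOMORPHIC OF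
REGULAR WEIGHT over K: ∃ RA cuspidal π on GL₅(𝔸_K), 𝒪 ⊂ ℂ holding the q²-normalised (HLTT) Hecke
polynomials a.e., θ : 𝒪 → k ⊇ 𝔽₃ reducing them to charpolys of GEOMETRIC Frobenius (ρ̄|Γ_K σ)⁻¹.
Chain: ν of any GSp₄(𝔽₃)-lift is FORCED = parity = ε̄, Br(ℚ)[2]-obstruction 0 (ramified only at 3·∞,
order-2 local lifts); BCGP2025 §9.4 'switching' (P(ρ̄) rational [BoxerEtAl2021] + weak approximation
at 2,3,∞) gives B = Jac(X)/ℚ, B[3] ≅ lift, good ordinary at 3; BCGP's 2-adic theorem ⇒ B modular;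
Hida [Pilloni2012] ⇒ regular ordinary g, ρ̄_g ≅ lift; Arthur GSp₄→GL₄ [GeeTaibi2019] + Kim2002 ∧² =
ν ⊞ Π₅, Π₅ RA cuspidal, r̄(Π₅) ≅ ρ̄⊗ε̄; BC to K [ArthurClozel1989] kills ε̄. Kill-tests:
NOTES/rationale. -/
@[route_item "route-Langlands-CubicSurfaceE6Transport"]
def E6ResidualTransport : Prop :=
  open Literature.NumberTheory.GaloisRepresentations Literature.NumberTheory.Automorphic Polynomial NumberField IsDedekindDomain in ∀ ρ : FramedGaloisRep ℚ (ZMod 3) 5, ((∀ σ, ((ρ σ : GL (Fin 5) (ZMod 3)) : Matrix (Fin 5) (Fin 5) (ZMod 3))ᵀ * (ρ σ : GL (Fin 5) (ZMod 3)) = 1 ∧ Matrix.det ((ρ σ : GL (Fin 5) (ZMod 3)) : Matrix (Fin 5) (Fin 5) (ZMod 3)) = 1) ∧ (∀ g : Matrix (Fin 5) (Fin 5) (ZMod 3), gᵀ * g = 1 → g.det = 1 → ∃ σ, ((ρ σ : GL (Fin 5) (ZMod 3)) : Matrix (Fin 5) (Fin 5) (ZMod 3)) = g) ∧ (∀ (σ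 : Field.absoluteGaloisGroup ℚ) (ζ : AlgebraicClosure ℚ), ζ ^ 2 + ζ + 1 = 0 → (σ • ζ = ζ ↔ ρ σ ∈ Subgroup.closure ((fun x : GL (Fin 5) (ZMod 3) ↦ x * x) '' {x | ((x : GL (Fin 5) (ZMod 3)) : Matrix (Fin 5) (Fin 5) (ZMod 3))ᵀ * x = 1}))) ∧ (∀ (φ : ℚ →+* ℝ) (c : Field.absoluteGaloisGroup ℚ), IsComplexConjugation φ c → Matrix.trace ((ρ c : GL (Fin 5) (ZMod 3)) : Matrix (Fin 5) (Fin 5) (ZMod 3)) = 1) ∧ (∀ v : HeightOneSpectrum (𝓞 ℚ), (2 : 𝓞 ℚ) ∈ v.asIdeal → ρ.IsUnramifiedAt v ∧ ∀ P, ρ.HasFrobCharpolyAt v P → P ≠ (X - 1) ^ 3 * (X ^ 2 + 1)) ∧ (∀ v : HeightOneSpectrum (𝓞 ℚ), (3 : 𝓞 ℚ) ∈ v.asIdeal → ∀ 𝔓 ∈ v.primesAbove, ∃ t : Matrix (Fin 5) (Fin 5) (ZMod 3), t * t = 1 ∧ Matrix.trace t = 1 ∧ (∀ σ ∈ 𝔓.inertia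 (Field.absoluteGaloisGroup ℚ), ((ρ σ : GL (Fin 5) (ZMod 3)) : Matrix (Fin 5) (Fin 5) (ZMod 3)) = 1 ∨ ((ρ σ : GL (Fin 5) (ZMod 3)) : Matrix (Fin 5) (Fin 5) (ZMod 3)) = t) ∧ (∃ σ ∈ 𝔓.inertia (Field.absoluteGaloisGroup ℚ), ((ρ σ : GL (Fin 5) (ZMod 3)) : Matrix (Fin 5) (Fin 5) (ZMod 3)) = t))) → ∃ (hcpt : isCompact_glFiniteIntegralLevel 5 (CyclotomicField 3 ℚ)) (π : CuspidalAutomorphicRepData 5 (CyclotomicField 3 ℚ) hcpt) (k : Type) (_ : Field k) (j : ZMod 3 →+* k) (𝒪 : Subring ℂ) (θ : 𝒪 →+* k), π.1.IsRegularAlgebraic ∧ ∀ᶠ v : HeightOneSpectrum (𝓞 (CyclotomicField 3 ℚ)) in cofinite, ∃ (α : Multiset ℂ) (P₀ : Polynomial 𝒪), π.1.HasSatakeParamAt v α ∧ P₀.map 𝒪.subtype = (α.map fun a ↦ X - C ((v.residueCard : ℂ) ^ 2 * a)).prod ∧ ∀ 𝔓 ∈ v.primesAbove, ∀ σ : Field.absoluteGaloisGroup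 (CyclotomicField 3 ℚ), IsArithFrobAt (𝓞 (CyclotomicField 3 ℚ)) σ 𝔓 → (((ρ.restrictField (CyclotomicField 3 ℚ) σ)⁻¹ : GL (Fin 5) (ZMod 3)) : Matrix (Fin 5) (Fin 5) (ZMod 3)).charpoly.map j = P₀.map θ

/-- item stmt-Langlands-3057 · crux · rank 3 · closed · moot by None · by planner
why it might fail: As typed: no P-ordinarity/weight hypothesis at lambda|3 (no Lean carrier), so it covers irregular NON-ordinary systems with no known method (NonRegularWeightBarrier); even the intended mu-ordinary U(4,1) case needs NEW higher Hida theory + Pan-style classicality at ramified p=3, 3 | #image.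
sources: BCGP2025ModularityAbelianSurfaces, BoxerEtAl2021, BoxerPilloni2021HigherColeman, CalegariGeraghty2017, Literature.Barriers.Langlands.NonRegularWeightBarrier, arXiv:2602.22189
[crux, rank 3: hardest node; irregular-weight lifting on the ACT ball quotient] Every rank-5
compatible system 𝓢 over K = ℚ(ω) that reduces a.e. at λ ∣ 3 (λ-integral arithmetic charpolys) to
ρ̄_K : Γ_K → SO₅(𝔽₃) with image ∋ every commutator of SO₅(𝔽₃) (⊇ Ω₅(𝔽₃) = PSp₄(𝔽₃)) which is
RESIDUALLY AUTOMORPHIC OF REGULAR WEIGHT (verbatim crux A's conclusion), with 𝓢.rep λ absolutely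
irreducible and 𝓢 polarised, is automorphic (∃ L-algebraic cuspidal π on GL₅(𝔸_K) matching
𝓢.charpoly a.e.). INTENDED SCOPE: μ- /P-ordinary systems of labelled HT type {0,1,1,1,1},{0,0,0,0,1}
at the ramified λ = (1-ω): μ-ordinary higher Hida theory for GU(4,1)/ℚ on integral models of the
Allcock–Carlson–Toledo ball quotient, irregular-weight R = 𝕋 patched on perfect complexes of
ordinary coherent cohomology [BoxerEtAl2021 template], Sen = Cousin classicality à la Pan/BCGP2025
§§3-5 for the singular weight, de Rhamness of the limit. AS TYPED it is STRONGER (no Lean carrier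
for labelled HT weights / P-ordinary flags ⇒ no condition at λ; definition item IsPOrdinaryAt filed,
restate in tenure): implied by the summit, not expected false, but beyond any method in this
generality. First node to SPLIT (higher Hida / -/
@[route_item "route-Langlands-CubicSurfaceE6Transport"]
def PolarisedLiftingRank5 : Prop :=
  open Literature.NumberTheory.GaloisRepresentations Literature.NumberTheory.Automorphic Polynomial NumberField IsDedekindDomain in ∀ (E : Type) [Field E] [NumberField E] (𝓢 : CompatibleSystem (CyclotomicField 3 ℚ) E 5), (∃ («λ» : HeightOneSpectrum (𝓞 E)) (j : ZMod 3 →+* 𝓞 E ⧸ «λ».asIdeal) (ρK : FramedGaloisRep (CyclotomicField 3 ℚ) (ZMod 3) 5), (∀ σ, ((ρK σ : GL (Fin 5) (ZMod 3)) : Matrix (Fin 5) (Fin 5) (ZMod 3))ᵀ * (ρK σ : GL (Fin 5) (ZMod 3)) = 1 ∧ Matrix.det ((ρK σ : GL (Fin 5) (ZMod 3)) : Matrix (Fin 5) (Fin 5) (ZMod 3)) = 1) ∧ (∀ g h : Matrix (Fin 5) (Fin 5) (ZMod 3), gᵀ * g = 1 → g.det = 1 → hᵀ * h = 1 → h.det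 = 1 → ∃ σ, ((ρK σ : GL (Fin 5) (ZMod 3)) : Matrix (Fin 5) (Fin 5) (ZMod 3)) = g * h * g⁻¹ * h⁻¹) ∧ (∃ (hcpt : isCompact_glFiniteIntegralLevel 5 (CyclotomicField 3 ℚ)) (π : CuspidalAutomorphicRepData 5 (CyclotomicField 3 ℚ) hcpt) (k : Type) (_ : Field k) (j : ZMod 3 →+* k) (𝒪 : Subring ℂ) (θ : 𝒪 →+* k), π.1.IsRegularAlgebraic ∧ ∀ᶠ v : HeightOneSpectrum (𝓞 (CyclotomicField 3 ℚ)) in cofinite, ∃ (α : Multiset ℂ) (P₀ : Polynomial 𝒪), π.1.HasSatakeParamAt v α ∧ P₀.map 𝒪.subtype = (α.map fun a ↦ X - C ((v.residueCard : ℂ) ^ 2 * a)).prod ∧ ∀ 𝔓 ∈ v.primesAbove, ∀ σ : Field.absoluteGaloisGroup (CyclotomicField 3 ℚ), IsArithFrobAt (𝓞 (CyclotomicField 3 ℚ)) σ 𝔓 → (((ρK σ)⁻¹ : GL (Fin 5) (ZMod 3)) : Matrix (Fin 5) (Fin 5) (ZMod 3)).charpoly.map j = P₀.map θ) ∧ FramedRep.IsAbsolutelyIrreducible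 (𝓢.rep «λ») ∧ (∀ᶠ v : HeightOneSpectrum (𝓞 (CyclotomicField 3 ℚ)) in cofinite, ∃ P₀ : Polynomial (𝓞 E), P₀.map (algebraMap (𝓞 E) E) = 𝓢.charpoly v ∧ ∀ 𝔓 ∈ v.primesAbove, ∀ σ : Field.absoluteGaloisGroup (CyclotomicField 3 ℚ), IsArithFrobAt (𝓞 (CyclotomicField 3 ℚ)) σ 𝔓 → ((ρK σ : GL (Fin 5) (ZMod 3)) : Matrix (Fin 5) (Fin 5) (ZMod 3)).charpoly.map j = P₀.map (Ideal.Quotient.mk «λ».asIdeal))) → (∃ a : ℤ, ∀ σ : CyclotomicField 3 ℚ ≃ₐ[ℚ] CyclotomicField 3 ℚ, σ ≠ AlgEquiv.refl → ∀ v w : HeightOneSpectrum (𝓞 (CyclotomicField 3 ℚ)), v ∉ 𝓢.bad → w ∉ 𝓢.bad → w.asIdeal = Ideal.comap (RingOfIntegers.mapRingHom σ.toRingEquiv.toRingHom) v.asIdeal → 𝓢.charpoly w = C ((𝓢.charpoly v).coeff 0)⁻¹ * ((𝓢.charpoly v).comp (C ((v.residueCard : E) ^ a) * X)).reverse) → ∀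 (emb : E →+* ℂ) (hcpt : isCompact_glFiniteIntegralLevel 5 (CyclotomicField 3 ℚ)), ∃ π : CuspidalAutomorphicRepData 5 (CyclotomicField 3 ℚ) hcpt, π.1.IsLAlgebraic ∧ ∀ᶠ v : HeightOneSpectrum (𝓞 (CyclotomicField 3 ℚ)) in cofinite, ∃ α : Multiset ℂ, π.1.HasSatakeParamAt v α ∧ (𝓢.charpoly v).map emb = (α.map fun a ↦ X - C a⁻¹).prod

-- item stmt-Langlands-3135 · support · rank 4 · closed · moot by None · by planner — informal only, no Lean statement yet:
--   [crux, rank 4 — informal until the definition items CubicSurface.linesOrthogonalRep /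
--   CubicSurface.occultCompatibleSystem land; the CLI's legacy rule files it as support meanwhile] THE
--   CUBIC-SURFACE CONTENT: (1) EXISTENCE: there are (infinitely many) smooth cubic surfaces S/ℚ with (a)
--   Gal(ℚ(27 lines)/ℚ) = W(E₆); (b) Δ(S) ∈ ℚ^{×2}, equivalently (ElsenhansJahnel2011 Thm 2.12: Gal ⊂
--   D¹W(E₆) iff -3Δ is a square) the quadratic subfield of ℚ(lines) is K = ℚ(ω), i.e. the spinor parity
--   of ρ̄' := det(ρ̄₂₇)·ρ̄₂₇ : Γ_ℚ → SO₅(𝔽₃) is ε̄ — this FORCES bad reduction at 3; (c) complex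
--   conjugation acts on the

/-- item stmt-Langlands-2586 · support · rank 9 · open · by planner
sources: HarrisLanTaylorThorneRMS2016, VarmaFMS2024, Scholze2015
[support] needs-fact (route-repair 2026-08-15, cone guardrail): the named fact
`Literature.NumberTheory.Automorphic.exists_galoisRep_of_regularAlgebraic` — Galois representations
attached to REGULAR algebraic cuspidal π of GL_n over totally real / CM fields with unramified
compatibility at every unramified v ∤ ℓ (HarrisLanTaylorThorneRMS2016 Thm. A; Scholze2015 Thm. 1.0.4
/ Cor. V.4.2; VarmaFMS2024 Thm. 1). This is the one cone fact on the Galois side that route CMFern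
genuinely rests on: it is the regular-weight sector of AutToGalCM (rank 3) and supplies the branches
ρ_{π_m} of FernDensity (rank 2). Tier-0 cone debt: it closes by the Literature theorem
`exists_galoisRep_of_regularAlgebraic_holds` once a provefact seat lands it (conditional reductions
already in tree: ReciprocityGLnProofs `exists_galoisRep_of_regularAlgebraic_of`,
ReciprocityGLnCor93Proofs); do NOT attempt it directly from this route. Not one of the route's
cruxes (a published theorem, size XL). -/
@[route_item "route-Langlands-CubicSurfaceE6Transport"]
def GaloisRepOfRegularAlgebraic : Prop :=
  Literature.NumberTheory.Automorphic.exists_galoisRep_of_regularAlgebraic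

/-- item stmt-Langlands-3058 · support · rank 9 · closed · moot by None · by planner
sources: Hunt1996, Dolgachev2012, AllcockCarlsonToledo2002
[support] Dictionary, first half (finite, kernel-checkable): the Coxeter group of type E₆ (Mathlib
CoxeterMatrix.E₆.Group, |W| = 51840) is isomorphic to SO₅(𝔽₃) = {g ∈ GL₅(𝔽₃) | gᵀg = 1, det g = 1},
via w ↦ det(w)·w on the quotient of E₆/3E₆ by its radical = Λ_S/(1-ω)Λ_S [AllcockCarlsonToledo2002];
Bourbaki Lie VI §4 Ex. 2; ATLAS U₄(2) ≅ S₄(3) ≅ O₅(3); Hunt1996 Ch. 5-6; Dolgachev2012 Ch. 9. Route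
to a proof: six elements det(r)·r, r orthogonal reflections in norm-1 vectors forming an E₆ diagram,
braid relations via PresentedGroup.toGroup, injectivity from simplicity of W(E₆)′ plus an order
count (decide/native computation acceptable only within the gate's axiom whitelist). -/
@[route_item "route-Langlands-CubicSurfaceE6Transport"]
def WeylE6IsoSO5F3 : Prop :=
  ∃ f : CoxeterMatrix.E₆.Group →* GL (Fin 5) (ZMod 3), Function.Injective f ∧ Set.range (fun w ↦ ((f w : GL (Fin 5) (ZMod 3)) : Matrix (Fin 5) (Fin 5) (ZMod 3))) = {g | gᵀ * g = 1 ∧ g.det = 1}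

/-- item stmt-Langlands-3059 · support · rank 9 · closed · moot by None · by planner
sources: Hunt1996, Dolgachev2012
[support] Dictionary, second half (exceptional isogeny B₂ = C₂ realised by ∧²₀ in characteristic 3):
a homomorphism Sp₄(𝔽₃) (Mathlib Matrix.symplecticGroup (Fin 2) (ZMod 3)) → GL₅(𝔽₃) with kernel {±1}
and image Ω₅(𝔽₃) = ⟨squares of SO₅(𝔽₃)⟩ (index 2, ≅ PSp₄(𝔽₃) ≅ W(E₆)′, simple of order 25920).
Construction: g ↦ ∧²g on ω^⊥ ⊂ ∧²(𝔽₃⁴) = ⟨ω⟩ ⊥ (5-dim), nondegenerate because ω∧ω ≠ 0 (2 ≠ 0 in 𝔽₃).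
Used in crux A to read ρ̄ : Γ_ℚ → SO₅(𝔽₃) as projective symplectic data; the similitude version
PGSp₄(𝔽₃) ≅ SO₅(𝔽₃) is 'ν mod squares = spinor norm' [Hunt1996, Dolgachev2012]. -/
@[route_item "route-Langlands-CubicSurfaceE6Transport"]
def Sp4F3OntoOmega5 : Prop :=
  ∃ f : Matrix.symplecticGroup (Fin 2) (ZMod 3) →* GL (Fin 5) (ZMod 3), (∀ x, f x = 1 ↔ ((x : Matrix (Fin 2 ⊕ Fin 2) (Fin 2 ⊕ Fin 2) (ZMod 3)) = 1 ∨ (x : Matrix (Fin 2 ⊕ Fin 2) (Fin 2 ⊕ Fin 2) (ZMod 3)) = -1)) ∧ Set.range (fun x ↦ ((f x : GL (Fin 5) (ZMod 3)) : Matrix (Fin 5) (Fin 5) (ZMod 3))) = (fun y : GL (Fin 5) (ZMod 3) ↦ (y : Matrix (Fin 5) (Fin 5) (ZMod 3))) '' (Subgroup.closure ((fun x : GL (Fin 5) (ZMod 3) ↦ x * x) '' {x | ((x : GL (Fin 5) (ZMod 3)) : Matrix (Fin 5) (Fin 5) (ZMod 3))ᵀ * x = 1 ∧ Matrix.det ((x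 : GL (Fin 5) (ZMod 3)) : Matrix (Fin 5) (Fin 5) (ZMod 3)) = 1}) : Set (GL (Fin 5) (ZMod 3)))

/-- item stmt-Langlands-3060 · assembly · rank 1 · closed · moot by None · by planner
sources: BCGP2025ModularityAbelianSurfaces
[assembly] E6ResidualTransport → PolarisedLiftingRank5 → OccultTypeAutomorphy. Pure glue, PROVED in
the planner sketch (folder Sketch.lean, theorem assembly_glue, lean check rc 0, 2026-08-15): from
the target's data (λ, j, ρ̄) set ρ̄_K := ρ̄.restrictField (CyclotomicField 3 ℚ); orthogonality of
ρ̄_K is that of ρ̄ (restrictField_apply is rfl); residual automorphy of ρ̄_K is crux A on the E6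
local type; the commutator, irreducibility, reduction and polarisation clauses pass verbatim; crux B
concludes. INSTANCE ROUTE: the chain ends in the route target (a family of instances of conjunct
(B), n = 5, K = ℚ(ω)), not in `Langlands` — deliberately. -/
@[route_item "route-Langlands-CubicSurfaceE6Transport"]
def Assembly : Prop :=
  E6ResidualTransport → PolarisedLiftingRank5 → OccultTypeAutomorphy

end Summit.Langlands.Langlands.Theses.CubicSurfaceE6Transport
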